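import Summits.HodgeConjecture.CorCM.SimpleCMThreefoldPairsHodge
import Summits.HodgeConjecture.CorCM.TwoSimpleCMSurfacesHodge
import Summits.HodgeConjecture.CorCM.SimpleCMSurfaceTimesThreefoldHodge
import Summits.HodgeConjecture.CorCM.CMEllipticCurveTimesSimpleCMThreefold
import HarnessLib

/-!
# Two simple CM abelian varieties of dimension `≤ 3`: `Hg(A₀ × A₁) = Hg(A₀) × Hg(A₁)` and the Hodge conjecture on every
# `A₀^a × A₁^b` iff the CM fields share NO imaginary quadratic subfield

COR-CM (cell `pub-hodgecm2`, binder seat `b16` gen 42, count-neutral claim CM33-QUADDISTINCT, file F8; theorems only, no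
definition, no named fact, no `sorry`).  NEW as stated, hence under `Summits/`.  ASSEMBLY: for two SIMPLE, NON-ISOGENOUS
CM abelian varieties `A₀`, `A₁` of dimensions `d₀, d₁ ≤ 3` (CM fields `K_i` of degree `2 d_i`, types `Φ_i`,
realisations on `H¹`) the tree decides every pair:

| `(d₀, d₁)` | verdict | source |
|---|---|---|
| `(1, d)`, `(d, 1)` | nondegenerate iff the curve's field does not embed in the other | `CMEllipticCurveTimesSimpleCMThreefold` (b16) |
| `(2, 2)` | always nondegenerate | `TwoSimpleCMSurfacesHodge` (b23) |
| `(2, 3)`, `(3, 2)` | always nondegenerate | `SimpleCMSurfaceTimesThreefoldHodge` (b16) |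
| `(3, 3)` | nondegenerate iff no common imaginary quadratic subfield | `SimpleCMThreefoldPairsHodge` (b16) |

and in every case the verdict is ONE criterion: **the two CM fields share no imaginary quadratic subfield** (a field
`F ≤ K_{i₀}` with `[F:ℚ] = 2`, `F` totally complex, `Hom(F, K_{i₁}) ≠ ∅`).  The necessity of the criterion is uniform
(b23's `not_isNondegenerateFamily_of_shared_imaginary_quadratic`); only sufficiency is assembled case by case.

* **`isNondegenerateFamily_simple_dim_le_three_iff`** — `(Φ₀, Φ₁)` nondegenerate ⟺ no common imaginary quadratic subfield;
* **`hodgeConjectureFor_prod_simple_dim_le_three`** — then the Hodge conjecture and `B• = D•` on every `⨁_{j<N} A_{π j}`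
  (every `A₀^a × A₁^b`), UNCONDITIONALLY; `forall_prod_hodgeClassSpan_eq_simple_dim_le_three_iff`;
* **`exists_exceptional_prod_simple_dim_le_three_iff`** — an exceptional Hodge class on some `A₀^a × A₁^b` ⟺ the fields DO
  share an imaginary quadratic subfield; `hodgeConjectureFor_prod_or_exists_exceptional_simple_dim_le_three`.

So for simple CM factors of dimension `≤ 3` the ONLY source of exceptional Hodge classes on `A₀^a × A₁^b` is a shared
imaginary quadratic field (Weil-type classes).  HC_CM is NOT proved and not touched.

## References

* [MoonenZarhin1999LowDim] B. Moonen, Yu. Zarhin, *Hodge classes on abelian varieties of low dimension*, Math. Ann. 315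
  (1999), Thm. (0.2), §§1–4.
* [Gordon1999HodgeAVSurvey] B. B. Gordon, *A survey of the Hodge conjecture for abelian varieties*, §3 Theorem, 7.4–7.7,
  9.4, 10.10.
* [Shimura1998] G. Shimura, *Abelian Varieties with Complex Multiplication and Modular Functions*, §8.2 Prop. 26, §8.4.
-/

noncomputable section

open CategoryTheory CategoryTheory.Limits NumberField Module

namespace Summit.HodgeConjecture.CorCM

open Literature.NumberTheory.ComplexMultiplication
open Literature.AlgebraicGeometry.Motives (AbelianVariety CMType)
open Literature.AlgebraicGeometry.HodgeTheory
open Literature.AlgebraicGeometry.ComplexMultiplication (IsCMTypeRealisation isSimple_iff_isPrimitive)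
open Literature.AlgebraicGeometry.VanGeemen1994 (hodgeClassSpan)
open Literature.AlgebraicGeometry.Pohlmann1968
open Literature.Barriers.HodgeConjecture (divisorClassesSpan)

/-! ## §1 Imaginary quadratic fields as common subfields -/

section Quadratic

variable {k M : Type} [Field k] [NumberField k] [IsTotallyComplex k] [Field M] [NumberField M]

/-- If the imaginary quadratic field `k` embeds in `M`, then `M` has a totally complex quadratic subfield mapping to `k`
(the image of `k`). [cite: Shimura1998, §8.4] -/
theorem exists_quadratic_subfield_of_ringHom (h2 : finrank ℚ k = 2) (g : k →+* M) :
    ∃ F : IntermediateField ℚ M, finrank ℚ F = 2 ∧ IsTotallyComplex F ∧ Nonempty (F →+* k) := by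
  letI iF : Algebra ℚ ↥g.toRatAlgHom.fieldRange := IntermediateField.algebra' _
  refine ⟨g.toRatAlgHom.fieldRange, ((AlgEquiv.ofInjectiveField g.toRatAlgHom).toLinearEquiv.finrank_eq).symm.trans h2,
    ?_, ⟨(AlgEquiv.ofInjectiveField g.toRatAlgHom).symm.toRingEquiv.toRingHom⟩⟩
  letI : Algebra k ↥g.toRatAlgHom.fieldRange := (AlgEquiv.ofInjectiveField g.toRatAlgHom).toRingEquiv.toRingHom.toAlgebra
  exact isTotallyComplex_of_algebra k _

omit [IsTotallyComplex k] in
/-- Conversely a (totally complex) quadratic subfield `F ≤ M` mapping to the quadratic field `k` IS (isomorphic to) `k`,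
so `k` embeds in `M`. [cite: Shimura1998, §8.4] -/
theorem nonempty_ringHom_of_quadratic_subfield (h2 : finrank ℚ k = 2) {F : IntermediateField ℚ M} (hF : finrank ℚ F = 2)
    (f : F →+* k) : Nonempty (k →+* M) := by
  haveI : FiniteDimensional ℚ k := Module.finite_of_finrank_pos (by rw [h2]; norm_num)
  -- `f : F → k` is a bijection (injective linear map between `ℚ`-planes)
  have hbij : Function.Bijective f.toRatAlgHom.toLinearMap := by
    refine ⟨f.injective, ?_⟩
    exact (LinearMap.injective_iff_surjective_of_finrank_eq_finrank (hF.trans h2.symm)).1 f.injective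
  let e : ↥F ≃+* k := RingEquiv.ofBijective f.toRatAlgHom hbij
  exact ⟨(algebraMap (↥F) M).comp e.symm.toRingHom⟩

omit [NumberField M] in
/-- For an imaginary quadratic `k` itself: a totally complex quadratic subfield of `k` mapping to `M` is all of `k`, so `k`
embeds in `M`; and conversely. [cite: Shimura1998, §8.4] -/
theorem exists_quadratic_subfield_self_iff (h2 : finrank ℚ k = 2) :
    (∃ F : IntermediateField ℚ k, finrank ℚ F = 2 ∧ IsTotallyComplex F ∧ Nonempty (F →+* M)) ↔ Nonempty (k →+* M) := by
  haveI : FiniteDimensional ℚ k := Module.finite_of_finrank_pos (by rw [h2]; norm_num)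
  constructor
  · rintro ⟨F, hF, -, ⟨f⟩⟩
    have htop : F = ⊤ := IntermediateField.eq_of_le_of_finrank_eq le_top (by rw [hF, IntermediateField.finrank_top', h2])
    subst htop
    exact ⟨f.comp (IntermediateField.topEquiv (F := ℚ) (E := k)).symm.toRingEquiv.toRingHom⟩
  · rintro ⟨g⟩
    refine ⟨⊤, by rw [IntermediateField.finrank_top', h2], ?_, ⟨g.comp (⊤ : IntermediateField ℚ k).val.toRingHom⟩⟩
    letI : Algebra k ↥(⊤ : IntermediateField ℚ k) :=
      (IntermediateField.topEquiv (F := ℚ) (E := k)).symm.toRingEquiv.toRingHom.toAlgebra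
    exact isTotallyComplex_of_algebra k _

end Quadratic

/-! ## §2 The census of pairs of simple CM abelian varieties of dimension `≤ 3` -/

section Census

variable {I : Type} {K : I → Type} [∀ i, Field (K i)] [∀ i, NumberField (K i)] [∀ i, IsCMField (K i)] [Fintype I]
  [DecidableEq I] [Nonempty I] {Φ : ∀ i, CMType (K i)}
variable {A : I → AbelianVariety ℂ} {ι : ∀ i, 𝓞 (K i) →+* End (A i)}
  {θ : ∀ i, K i →+* Module.End ℂ (complexBetti (A i).X 1)}

omit [∀ i, IsCMField (K i)] [Fintype I] [DecidableEq I] [Nonempty I] in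
/-- The CM field of a realisation of dimension `≤ 3` has degree `2`, `4` or `6`. [cite: Shimura1998, §5.2] -/
theorem finrank_eq_or_of_dim_le_three (hA : ∀ i, IsCMTypeRealisation (Φ i) (A i) (ι i) (θ i)) {i : I}
    (h3 : (A i).dim ≤ 3) : finrank ℚ (K i) = 2 ∨ finrank ℚ (K i) = 4 ∨ finrank ℚ (K i) = 6 := by
  have h := finrank_eq_two_mul_dim_of_isCMTypeRealisation (hA i)
  have hpos : 0 < finrank ℚ (K i) := Module.finrank_pos
  interval_cases hd : (A i).dim <;> omega

/-- A curve slot: with `K_{i₀}` quadratic and `A_{i₁}` simple of dimension `≤ 3`, the pair is nondegenerate iff `K_{i₀}`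
does not embed in `K_{i₁}` (Moonen–Zarhin). [cite: MoonenZarhin1999LowDim, Thm. (0.2)] -/
theorem isNondegenerateFamily_iff_isEmpty_of_quadratic_slot {i₀ i₁ : I} (h01 : i₀ ≠ i₁) (hI : ∀ j, j = i₀ ∨ j = i₁)
    (h2 : finrank ℚ (K i₀) = 2) (h6 : finrank ℚ (K i₁) ≤ 6) (hA : ∀ i, IsCMTypeRealisation (Φ i) (A i) (ι i) (θ i))
    (hS : ∀ i, (A i).IsSimple) (hniso : ∀ i j, i ≠ j → ¬ AbelianVariety.IsIsogenous (A i) (A j)) :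
    CMAlgebra.IsNondegenerateFamily Φ ↔ IsEmpty (K i₀ →+* K i₁) := by
  obtain ⟨φ₀⟩ : Nonempty (K i₁ →+* ℂ) := inferInstance
  have h2' : ∀ j, j ≠ i₁ → finrank ℚ (K j) = 2 := fun j hj => by
    rcases hI j with rfl | rfl
    · exact h2
    · exact absurd rfl hj
  have hsep := isSeparatingFamily_subtype
    (CMAlgebra.isSeparatingFamily_of_isSimple_of_pairwise_not_isIsogenous hA hS hniso) (fun j => j ≠ i₁)
  rw [isNondegenerateFamily_iff_forall_isEmpty_of_finrank_le_six i₁ Φ h2' hsep h6 φ₀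
    ((isSimple_iff_isPrimitive (hA i₁) φ₀).1 (hS i₁))]
  constructor
  · exact fun h => h i₀ h01
  · intro h a ha
    rcases hI a with rfl | rfl
    · exact h
    · exact absurd rfl ha

/-- **The census of pairs of simple CM abelian varieties of dimension `≤ 3`, types level.**  For two SIMPLE,
NON-ISOGENOUS CM abelian varieties of dimension `≤ 3` with CM fields `K_{i₀}`, `K_{i₁}`: the pair of their types is
nondegenerate (`Hg(A₀ × A₁) = Hg(A₀) × Hg(A₁)`) iff NO totally complex quadratic subfield of `K_{i₀}` embeds in `K_{i₁}`.
[cite: MoonenZarhin1999LowDim, Thm. (0.2)] [cite: Gordon1999HodgeAVSurvey, §3 Theorem, 7.4–7.7 and 9.4] -/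
theorem isNondegenerateFamily_simple_dim_le_three_iff {i₀ i₁ : I} (h01 : i₀ ≠ i₁) (hI : ∀ j, j = i₀ ∨ j = i₁)
    (hA : ∀ i, IsCMTypeRealisation (Φ i) (A i) (ι i) (θ i)) (hS : ∀ i, (A i).IsSimple)
    (hniso : ∀ i j, i ≠ j → ¬ AbelianVariety.IsIsogenous (A i) (A j)) (h3 : ∀ i, (A i).dim ≤ 3) :
    CMAlgebra.IsNondegenerateFamily Φ ↔
      ¬ ∃ F : IntermediateField ℚ (K i₀), finrank ℚ F = 2 ∧ IsTotallyComplex F ∧ Nonempty (F →+* K i₁) := by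
  constructor
  · -- a common imaginary quadratic subfield forces degeneracy, in every dimension (b23)
    rintro hnd ⟨F, hF2, hFtc, ⟨j₁⟩⟩
    haveI := hFtc
    exact not_isNondegenerateFamily_of_shared_imaginary_quadratic (k := ↥F) hF2 h01 (algebraMap (↥F) (K i₀)) j₁ Φ hnd
  · intro hno
    have hI' : ∀ j, j = i₁ ∨ j = i₀ := fun j => (hI j).symm
    have hniso' := hniso
    rcases finrank_eq_or_of_dim_le_three hA (h3 i₀) with h₀ | h₀ | h₀ <;>
      rcases finrank_eq_or_of_dim_le_three hA (h3 i₁) with h₁ | h₁ | h₁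
    -- `K_{i₀}` quadratic: nondegenerate iff `K_{i₀} ↪̸ K_{i₁}`, and an embedding would be a common quadratic subfield
    · refine (isNondegenerateFamily_iff_isEmpty_of_quadratic_slot h01 hI h₀ (by omega) hA hS hniso).2 ⟨fun g => hno ?_⟩
      exact (exists_quadratic_subfield_self_iff (M := K i₁) h₀).2 ⟨g⟩
    · refine (isNondegenerateFamily_iff_isEmpty_of_quadratic_slot h01 hI h₀ (by omega) hA hS hniso).2 ⟨fun g => hno ?_⟩
      exact (exists_quadratic_subfield_self_iff (M := K i₁) h₀).2 ⟨g⟩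
    · refine (isNondegenerateFamily_iff_isEmpty_of_quadratic_slot h01 hI h₀ (by omega) hA hS hniso).2 ⟨fun g => hno ?_⟩
      exact (exists_quadratic_subfield_self_iff (M := K i₁) h₀).2 ⟨g⟩
    -- `K_{i₀}` quartic (a simple CM surface)
    · -- × curve: nondegenerate iff `K_{i₁} ↪̸ K_{i₀}`; an embedding gives a common imaginary quadratic subfield
      refine (isNondegenerateFamily_iff_isEmpty_of_quadratic_slot h01.symm hI' h₁ (by omega) hA hS hniso).2
        ⟨fun g => hno ?_⟩
      exact exists_quadratic_subfield_of_ringHom h₁ g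
    · -- × surface: always (b23)
      exact isNondegenerateFamily_simpleSurfaces h01 hI (fun i => by rcases hI i with rfl | rfl <;> assumption) hA hS hniso
    · -- × threefold: always
      exact isNondegenerateFamily_simpleSurface_simpleThreefold h01 hI h₀ h₁ hA (hS i₀) (hS i₁)
    -- `K_{i₀}` sextic (a simple CM threefold)
    · refine (isNondegenerateFamily_iff_isEmpty_of_quadratic_slot h01.symm hI' h₁ (by omega) hA hS hniso).2
        ⟨fun g => hno ?_⟩
      exact exists_quadratic_subfield_of_ringHom h₁ g
    · exact isNondegenerateFamily_simpleSurface_simpleThreefold h01.symm hI' h₁ h₀ hA (hS i₁) (hS i₀)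
    · exact (isNondegenerateFamily_simpleThreefolds_iff h01 hI
        (fun i => by rcases hI i with rfl | rfl <;> assumption) hA hS hniso).2 hno

/-- **The Hodge conjecture and `B• = D•` on every `A₀^a × A₁^b`** (every `⨁_{j<N} A_{π j}`) of two simple, non-isogenous
CM abelian varieties of dimension `≤ 3` whose CM fields share no imaginary quadratic subfield — UNCONDITIONALLY.
[cite: MoonenZarhin1999LowDim, Thm. (0.2)] [cite: Gordon1999HodgeAVSurvey, §3 Theorem and 10.10] -/
theorem hodgeConjectureFor_prod_simple_dim_le_three {i₀ i₁ : I} (h01 : i₀ ≠ i₁) (hI : ∀ j, j = i₀ ∨ j = i₁)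
    (hA : ∀ i, IsCMTypeRealisation (Φ i) (A i) (ι i) (θ i)) (hS : ∀ i, (A i).IsSimple)
    (hniso : ∀ i j, i ≠ j → ¬ AbelianVariety.IsIsogenous (A i) (A j)) (h3 : ∀ i, (A i).dim ≤ 3)
    (hno : ¬ ∃ F : IntermediateField ℚ (K i₀), finrank ℚ F = 2 ∧ IsTotallyComplex F ∧ Nonempty (F →+* K i₁))
    {N : ℕ} (π : Fin N → I) :
    HodgeConjectureFor (⨁ fun j : Fin N => A (π j)).dim (⨁ fun j : Fin N => A (π j)).X ∧
      ∀ m : ℕ, hodgeClassSpan (⨁ fun j : Fin N => A (π j)).dim (⨁ fun j : Fin N => A (π j)).X m =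
        divisorClassesSpan (⨁ fun j : Fin N => A (π j)).X (⨁ fun j : Fin N => A (π j)).dim m :=
  have h := (isNondegenerateFamily_simple_dim_le_three_iff h01 hI hA hS hniso h3).2 hno
  ⟨h.hodgeConjectureFor_prod hA π, fun m => h.hodgeClassSpan_prod_eq_divisorClassesSpan hA π m⟩

/-- **`B• = D•` on every `A₀^a × A₁^b` iff the CM fields share no imaginary quadratic subfield** (two simple, non-isogenous
CM abelian varieties of dimension `≤ 3`). [cite: MoonenZarhin1999LowDim, Thm. (0.2)] [cite: Gordon1999HodgeAVSurvey, 7.5–7.7] -/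
theorem forall_prod_hodgeClassSpan_eq_simple_dim_le_three_iff {i₀ i₁ : I} (h01 : i₀ ≠ i₁)
    (hI : ∀ j, j = i₀ ∨ j = i₁) (hA : ∀ i, IsCMTypeRealisation (Φ i) (A i) (ι i) (θ i)) (hS : ∀ i, (A i).IsSimple)
    (hniso : ∀ i j, i ≠ j → ¬ AbelianVariety.IsIsogenous (A i) (A j)) (h3 : ∀ i, (A i).dim ≤ 3) :
    (∀ (N : ℕ) (π : Fin N → I) (m : ℕ),
        hodgeClassSpan (⨁ fun j : Fin N => A (π j)).dim (⨁ fun j : Fin N => A (π j)).X m =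
          divisorClassesSpan (⨁ fun j : Fin N => A (π j)).X (⨁ fun j : Fin N => A (π j)).dim m) ↔
      ¬ ∃ F : IntermediateField ℚ (K i₀), finrank ℚ F = 2 ∧ IsTotallyComplex F ∧ Nonempty (F →+* K i₁) :=
  (CMAlgebra.isNondegenerateFamily_iff_forall_prod_hodgeClassSpan_eq
      (CMAlgebra.isSeparatingFamily_of_isSimple_of_pairwise_not_isIsogenous hA hS hniso) hA).symm.trans
    (isNondegenerateFamily_simple_dim_le_three_iff h01 hI hA hS hniso h3)

/-- **An exceptional Hodge class on some `A₀^a × A₁^b` iff the CM fields SHARE an imaginary quadratic subfield** — for two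
simple, non-isogenous CM abelian varieties of dimension `≤ 3` the only exceptional classes are Weil-type classes of a
common imaginary quadratic field (not claimed algebraic or non-algebraic here).
[cite: MoonenZarhin1999LowDim, Thm. (0.2)] [cite: Gordon1999HodgeAVSurvey, 7.5–7.7 and 9.4] -/
theorem exists_exceptional_prod_simple_dim_le_three_iff {i₀ i₁ : I} (h01 : i₀ ≠ i₁) (hI : ∀ j, j = i₀ ∨ j = i₁)
    (hA : ∀ i, IsCMTypeRealisation (Φ i) (A i) (ι i) (θ i)) (hS : ∀ i, (A i).IsSimple)
    (hniso : ∀ i j, i ≠ j → ¬ AbelianVariety.IsIsogenous (A i) (A j)) (h3 : ∀ i, (A i).dim ≤ 3) :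
    (∃ (N : ℕ) (π : Fin N → I) (m : ℕ) (c : complexBetti (⨁ fun j : Fin N => A (π j)).X (2 * m)),
        IsRationalClass c ∧
        IsOfHodgeType (⨁ fun j : Fin N => A (π j)).dim (⨁ fun j : Fin N => A (π j)).X (2 * m) m m c ∧
        c ∉ divisorClassesSpan (⨁ fun j : Fin N => A (π j)).X (⨁ fun j : Fin N => A (π j)).dim m) ↔
      ∃ F : IntermediateField ℚ (K i₀), finrank ℚ F = 2 ∧ IsTotallyComplex F ∧ Nonempty (F →+* K i₁) := by
  have hsep := CMAlgebra.isSeparatingFamily_of_isSimple_of_pairwise_not_isIsogenous hA hS hniso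
  constructor
  · rintro ⟨N, π, m, c, hc, hpq, hnot⟩
    by_contra hno
    exact ((isNondegenerateFamily_simple_dim_le_three_iff h01 hI hA hS hniso h3).2 hno).not_exists_exceptional_prod hA π m
      ⟨c, hc, hpq, hnot⟩
  · intro hF
    exact CMAlgebra.exists_exceptional_prod_of_not_isNondegenerateFamily hsep
      (fun hnd => (isNondegenerateFamily_simple_dim_le_three_iff h01 hI hA hS hniso h3).1 hnd hF) hA

/-- **The dichotomy for two simple, non-isogenous CM abelian varieties of dimension `≤ 3`**, packaged: EITHER the CM fields
share no imaginary quadratic subfield and the Hodge conjecture (with `B• = D•`) holds on every `A₀^a × A₁^b`, OR they share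
one and some `A₀^a × A₁^b` carries an exceptional Hodge class. [cite: MoonenZarhin1999LowDim, Thm. (0.2)]
[cite: Gordon1999HodgeAVSurvey, 7.5–7.7 and 10.10] -/
theorem hodgeConjectureFor_prod_or_exists_exceptional_simple_dim_le_three {i₀ i₁ : I} (h01 : i₀ ≠ i₁)
    (hI : ∀ j, j = i₀ ∨ j = i₁) (hA : ∀ i, IsCMTypeRealisation (Φ i) (A i) (ι i) (θ i)) (hS : ∀ i, (A i).IsSimple)
    (hniso : ∀ i j, i ≠ j → ¬ AbelianVariety.IsIsogenous (A i) (A j)) (h3 : ∀ i, (A i).dim ≤ 3) :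
    ((¬ ∃ F : IntermediateField ℚ (K i₀), finrank ℚ F = 2 ∧ IsTotallyComplex F ∧ Nonempty (F →+* K i₁)) ∧
        ∀ (N : ℕ) (π : Fin N → I),
          HodgeConjectureFor (⨁ fun j : Fin N => A (π j)).dim (⨁ fun j : Fin N => A (π j)).X ∧
            ∀ m : ℕ, hodgeClassSpan (⨁ fun j : Fin N => A (π j)).dim (⨁ fun j : Fin N => A (π j)).X m =
              divisorClassesSpan (⨁ fun j : Fin N => A (π j)).X (⨁ fun j : Fin N => A (π j)).dim m) ∨
      ((∃ F : IntermediateField ℚ (K i₀), finrank ℚ F = 2 ∧ IsTotallyComplex F ∧ Nonempty (F →+* K i₁)) ∧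
        ∃ (N : ℕ) (π : Fin N → I) (m : ℕ) (c : complexBetti (⨁ fun j : Fin N => A (π j)).X (2 * m)),
          IsRationalClass c ∧
          IsOfHodgeType (⨁ fun j : Fin N => A (π j)).dim (⨁ fun j : Fin N => A (π j)).X (2 * m) m m c ∧
          c ∉ divisorClassesSpan (⨁ fun j : Fin N => A (π j)).X (⨁ fun j : Fin N => A (π j)).dim m) := by
  by_cases hF : ∃ F : IntermediateField ℚ (K i₀), finrank ℚ F = 2 ∧ IsTotallyComplex F ∧ Nonempty (F →+* K i₁)
  · exact Or.inr ⟨hF, (exists_exceptional_prod_simple_dim_le_three_iff h01 hI hA hS hniso h3).2 hF⟩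
  · exact Or.inl ⟨hF, fun N π => hodgeConjectureFor_prod_simple_dim_le_three h01 hI hA hS hniso h3 hF π⟩

end Census

end Summit.HodgeConjecture.CorCM

end
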